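import Literature.NumberTheory.EllipticCurves.MazurTateElementKuriharaCoefficient
import Literature.NumberTheory.EllipticCurves.PAdicLFunctionMinus
import HarnessLib

/-!
# Otsuki 2009, §3: the level maps `π_{M/L}`, `ν_{M/L}` on `R[(ℤ/M)ˣ]`, ADMISSIBLE SYSTEMS, and the plus+minus
# Mazur–Tate modular elements `θ_N` (definitions)

Topic `Literature/NumberTheory/EllipticCurves`, cluster `Otsuki2009` (namespace = path). A DEFINITION file transcribing
Rei Otsuki, *Construction of a homomorphism concerning Euler systems for an elliptic curve*, Tokyo J. Math. **32** (2009)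
253–278 [Otsuki2009] (held copy `paper:doi-10-3836-tjm-1249648421`, printed page = PDF page + 252), **§3 pp. 265–266**:
the restriction and "norm" maps between the group rings of the `G_M = Gal(ℚ(μ_M)/ℚ) = (ℤ/M)ˣ`, the two Mazur–Tate
compatibilities defining an ADMISSIBLE SYSTEM, and the modular elements `θ_N`. VOCABULARY ONLY — definitions with bodies
and unfolding lemmas; NOTHING is asserted (Thm. 3.4 «Euler system ⟹ admissible system», Thm. 3.6 «`P_N(z_N) = θ_N`» and
Thm. 4.1 (integrality, `p = 2` included, p. 277) are NOT stated here: they are the business of a sibling named-fact file).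
HONEST FRAMING (cell `bsd-wall`, K3 `SignedKatoDivisibilityUpToAtTwo` stmt-BirchSwinnertonDyer-20308, input (Z1) of the promoted
research stub; typer TURNKEY of the route pen `bsd-wall-pss3x`): this is the currency in which the explicit-reciprocity half of
Kobayashi's Coleman map at `p = 2` is PRINTED; it closes nothing; BSD is not proved by any of this.

## Source, verbatim (p. 265–266)

p. 265: «Mazur-Tate [8] defined the modular element `θ_N ∈ ℚ[G_N]` by `θ_N := Σ_{a ∈ (ℤ/Nℤ)ˣ} ([a/N]⁺_E + [a/N]⁻_E) σ_a`. Here,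
for `r ∈ ℚ`, `[r]^±_E ∈ ℝ` are defined by `2π ∫₀^∞ f(r + iy) dy = [r]⁺_E Ω⁺_E + [r]⁻_E Ω⁻_E`». p. 266: «For each prime number
`q`, they satisfy compatible formulas below. `π_{qM/M}(θ_{qM}) = a_q θ_M − ε_q ν_{M/(M/q)}(θ_{M/q})` (`q ∣ M`),
`= (a_q − σ_q − ε_q σ_q⁻¹) θ_M` (`q ∤ M`). Here, for integers `L` and `M` with `L` dividing `M`, the map
`π_{M/L} : ℚ_p[G_M] → ℚ_p[G_L]` is defined by the restriction map of the Galois group `G_M → G_L`, and the map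
`ν_{M/L} : ℚ_p[G_L] → ℚ_p[G_M]` is defined by `σ ↦ Σ_{τ ∈ G_M, π_{M/L}(τ) = σ} τ` for `σ ∈ G_L`. In this paper, we call a
system of elements `(η_M)_M ∈ ∏_{M ∣ N} ℚ_p[G_M]` an admissible system, when they satisfy the same compatible formulas.»
(Def. 1.2, p. 257: `ε_l = 1` for a good prime `l`, `0` for a bad prime; `a_l` the Hecke eigenvalue.)

## Transcription

* Coefficients `R` (any commutative ring: `ℚ_p`, `ℤ_p`, `ℚ`); `G_M := (ZMod M)ˣ`; `R[G_M] := MonoidAlgebra R (ZMod M)ˣ` — the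
  tree's currency for Mazur–Tate elements (`MazurTate.modularElement f n : MonoidAlgebra ℚ (ZMod n)ˣ`, the PLUS part
  `Σ_a [a/n]⁺_f δ_a`, file `MazurTateElementKuriharaCoefficient`), which is CITED, not restated.
* `levelRestrict R h = π_{M/L}` (`L ∣ M`): `MonoidAlgebra.mapDomainRingHom` along Mathlib's `ZMod.unitsMap h : (ZMod M)ˣ →* (ZMod L)ˣ`.
* `levelNorm R h = ν_{M/L}`: `x ↦ Σ_{τ ∈ G_M} x(π τ) · τ` (for `x = σ` this is `Σ_{π τ = σ} τ`).
* `frobUnit q h = σ_q ∈ G_M` for `q` coprime to `M` (Mathlib `ZMod.unitOfCoprime`).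
* `IsAdmissibleSystem R N a ε η`: the two displayed relations for every prime `q` and every `M ≥ 1` with `qM ∣ N`; the
  parameters `a ε : ℕ → R` are Otsuki's `a_q`, `ε_q` (kept abstract: the definition is pure algebra).
* `modularElementPM f M = θ_M` with the TREE's rational symbols `ratPlusSymbol f` / `ratMinusSymbol f` (periods `Ω^±_f` of the
  tree; Otsuki uses the Néron periods `Ω^±_E` — the two normalisations differ by rational factors, cf. the docstring of
  `MazurTate.modularElement`; we do NOT identify them) — `TODO(general form)`: Otsuki's own `Ω_E^±` normalisation.

References: [Otsuki2009] §3 (pp. 265–266), Def. 1.2 (p. 257), Remark 3.3; [MazurTate1987] B. Mazur, J. Tate, Duke Math. J. 54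
(1987) §1; [Kurihara2014] §1.1 (the plus modular element).
-/

noncomputable section

open scoped Classical

namespace Literature.NumberTheory.EllipticCurves.Otsuki2009

open Literature.NumberTheory.EllipticCurves CongruenceSubgroup

/-! ## The level maps `π_{M/L}` and `ν_{M/L}` -/

section LevelMaps

variable (R : Type*) [CommRing R]

/-- **`π_{M/L} : R[G_M] → R[G_L]`** for `L ∣ M`: the ring map of group rings induced by the restriction
`G_M = (ℤ/M)ˣ → (ℤ/L)ˣ = G_L` (Mathlib `ZMod.unitsMap`), «defined by the restriction map of the Galois group `G_M → G_L`».
[cite: Otsuki2009, §3 (p. 266)] -/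
def levelRestrict {L M : ℕ} (h : L ∣ M) : MonoidAlgebra R (ZMod M)ˣ →+* MonoidAlgebra R (ZMod L)ˣ :=
  MonoidAlgebra.mapDomainRingHom R (ZMod.unitsMap h)

/-- `π_{M/L}` on a group element: `π(τ) = τ̄` (`single τ r ↦ single (unitsMap τ) r`). [cite: Otsuki2009, §3 (p. 266)] -/
theorem levelRestrict_single {L M : ℕ} (h : L ∣ M) (τ : (ZMod M)ˣ) (r : R) :
    levelRestrict R h (MonoidAlgebra.single τ r) = MonoidAlgebra.single (ZMod.unitsMap h τ) r := by
  simp [levelRestrict, MonoidAlgebra.mapDomainRingHom, MonoidAlgebra.mapDomain_single]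

/-- **`ν_{M/L} : R[G_L] → R[G_M]`** for `L ∣ M`: «`σ ↦ Σ_{τ ∈ G_M, π_{M/L}(τ) = σ} τ`», i.e. `x ↦ Σ_{τ ∈ G_M} x(π τ) · τ`
(additive; not multiplicative). [cite: Otsuki2009, §3 (p. 266)] -/
def levelNorm {L M : ℕ} [NeZero M] (h : L ∣ M) : MonoidAlgebra R (ZMod L)ˣ →+ MonoidAlgebra R (ZMod M)ˣ where
  toFun x := ∑ τ : (ZMod M)ˣ, MonoidAlgebra.single τ (x.coeff (ZMod.unitsMap h τ))
  map_zero' := by simp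
  map_add' x y := by
    simp only [MonoidAlgebra.coeff_add, Finsupp.add_apply, MonoidAlgebra.single_add, Finset.sum_add_distrib]

/-- Unfolding `ν_{M/L}`. [cite: Otsuki2009, §3 (p. 266)] -/
theorem levelNorm_apply {L M : ℕ} [NeZero M] (h : L ∣ M) (x : MonoidAlgebra R (ZMod L)ˣ) :
    levelNorm R h x = ∑ τ : (ZMod M)ˣ, MonoidAlgebra.single τ (x.coeff (ZMod.unitsMap h τ)) :=
  rfl

/-- **`σ_q ∈ G_M`**: the class of a natural number `q` coprime to `M` (for a prime `q ∤ M`: the arithmetic Frobenius of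
`ℚ(μ_M)/ℚ` at `q`, `ζ ↦ ζ^q`) — Mathlib's `ZMod.unitOfCoprime`. [cite: Otsuki2009, §3 (p. 266)] -/
def frobUnit {M : ℕ} (q : ℕ) (h : q.Coprime M) : (ZMod M)ˣ :=
  ZMod.unitOfCoprime q h

/-- `(σ_q : ℤ/M) = q`. [cite: Otsuki2009, §3 (p. 266)] -/
theorem coe_frobUnit {M : ℕ} (q : ℕ) (h : q.Coprime M) : ((frobUnit q h : (ZMod M)ˣ) : ZMod M) = q :=
  ZMod.coe_unitOfCoprime q h

end LevelMaps

/-! ## Admissible systems -/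

section Admissible

variable (R : Type*) [CommRing R]

/-- **Admissible system** (Otsuki §3, p. 266): a family `η = (η_M)_M`, `η_M ∈ R[G_M]`, is ADMISSIBLE (relative to the level `N`
and the coefficients `a_q, ε_q ∈ R`, `q` prime — in the source `a_q` = Hecke eigenvalue, `ε_q = 1`/`0` for good/bad `q`, Def. 1.2)
when for every prime `q` and every `M ≥ 1` with `qM ∣ N`:
`π_{qM/M}(η_{qM}) = a_q η_M − ε_q ν_{M/(M/q)}(η_{M/q})` if `q ∣ M`, and
`π_{qM/M}(η_{qM}) = (a_q − σ_q − ε_q σ_q⁻¹) η_M` if `q ∤ M` — «the same compatible formulas» as the modular elements.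
(The family is indexed by all `M : ℕ`; only the levels `M ∣ N`, `M ≥ 1` are constrained.) [cite: Otsuki2009, §3 (p. 266)] -/
def IsAdmissibleSystem (N : ℕ) (a ε : ℕ → R) (η : (M : ℕ) → MonoidAlgebra R (ZMod M)ˣ) : Prop :=
  ∀ (q M : ℕ), q.Prime → (hM : 0 < M) → q * M ∣ N →
    haveI : NeZero M := ⟨hM.ne'⟩
    (∀ hqM : q ∣ M,
      levelRestrict R (dvd_mul_left M q) (η (q * M)) =
        a q • η M - ε q • levelNorm R (Nat.div_dvd_of_dvd hqM) (η (M / q))) ∧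
    (∀ hq : q.Coprime M,
      levelRestrict R (dvd_mul_left M q) (η (q * M)) =
        (a q • (1 : MonoidAlgebra R (ZMod M)ˣ) - MonoidAlgebra.single (frobUnit q hq) 1 -
            ε q • MonoidAlgebra.single (frobUnit q hq)⁻¹ 1) * η M)

end Admissible

/-! ## The plus+minus modular elements `θ_M` -/

section ModularElement

variable {N : ℕ} (f : CuspForm (Gamma0 N) 2)

/-- **Otsuki's / Mazur–Tate's modular element with BOTH signs**, `θ_M = Σ_{a ∈ (ℤ/M)ˣ} ([a/M]⁺ + [a/M]⁻) σ_a ∈ ℚ[G_M]` (p. 265),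
in the tree's normalisation of the symbols (`ratPlusSymbol f`, `ratMinusSymbol f`, periods `Ω^±_f`; `a` represented by
`a.val ∈ [0, M)` as in `MazurTate.modularElement`). The PLUS part alone is the tree's `MazurTate.modularElement f M`
(`modularElementPM_eq_modularElement_add`). Otsuki's own definition uses the Néron periods `Ω^±_E`.
-- TODO(general form): the Néron-period normalisation `[r]^±_E` of the source.
[cite: Otsuki2009, §3 (p. 265) and Remark 3.3 (p. 266)] -/
def modularElementPM (M : ℕ) [NeZero M] : MonoidAlgebra ℚ (ZMod M)ˣ :=
  ∑ a : (ZMod M)ˣ, MonoidAlgebra.single a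
    (ratPlusSymbol f (((a : ZMod M).val : ℚ) / M) + ratMinusSymbol f (((a : ZMod M).val : ℚ) / M))

/-- The coefficient of `σ_a` in `θ_M` is `[a/M]⁺_f + [a/M]⁻_f`. [cite: Otsuki2009, §3 (p. 265)] -/
theorem coeff_modularElementPM (M : ℕ) [NeZero M] (a : (ZMod M)ˣ) :
    (modularElementPM f M).coeff a =
      ratPlusSymbol f (((a : ZMod M).val : ℚ) / M) + ratMinusSymbol f (((a : ZMod M).val : ℚ) / M) := by
  classical
  rw [modularElementPM, MonoidAlgebra.coeff_sum, Finsupp.finsetSum_apply, Finset.sum_eq_single a]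
  · simp
  · intro b _ hb; simp [hb]
  · intro h; exact absurd (Finset.mem_univ a) h

/-- The minus-part element `Σ_a [a/M]⁻_f σ_a` added to the tree's plus modular element gives `θ_M`:
`modularElementPM f M = MazurTate.modularElement f M + Σ_a [a/M]⁻ σ_a`. [cite: Otsuki2009, §3 (p. 265) and Remark 3.3] -/
theorem modularElementPM_eq_modularElement_add (M : ℕ) [NeZero M] :
    modularElementPM f M = modularElement f M +
      ∑ a : (ZMod M)ˣ, MonoidAlgebra.single a (ratMinusSymbol f (((a : ZMod M).val : ℚ) / M)) := by
  rw [modularElementPM, modularElement, ← Finset.sum_add_distrib]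
  refine Finset.sum_congr rfl fun a _ ↦ ?_
  rw [MonoidAlgebra.single_add]

end ModularElement

end Literature.NumberTheory.EllipticCurves.Otsuki2009

end
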